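import Mathlib
import HarnessLib
import Summits.HubbardSuperconductivity.HubbardSuperconductivity.Theorems.KLProgrammeKLRegimeTwoVolumeTowerTruncProfileBridge
import Summits.HubbardSuperconductivity.HubbardSuperconductivity.Theorems.KLProgrammeKLRegimeEngineTowerModelDefsRate

/-!
# Route `KLProgramme` — crux K3, VL child `KLRegimeVolumeLimitV17F2` (stmt-HubbardSuperconductivity-20440), blueprint v5 M5-T: THE PROFILE FIELD OF THE
# SOURCE-TRUNCATED BUNDLE FROM E1's OWN READ-OUT CURRENCY ⊕ TOKEN #24 (located «(VL)-SRC-HIGH»; seat hubbard-kl-k3c4-p1 g14; `--supports` 20440)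

`…TowerTruncProfileBridge.wtProfileEven_srcTrunc_klTowerD_of_srcPinnedSumAt` reads the three source counts `s = 0, 1, 2` in token #24's currency
`klSrcPinnedSumAt`.  E1's (R75f)(a) read-out speaks `EngineV8.klWtPinnedSumAt V M β μ K J r m 𝒱 q w` (alive labels, no copies).  This file identifies the
`s = 0` part with E1's currency and states the profile field in the two producers' OWN words:

* `srcCount_eq_zero_iff` — a doubled string has no source leg iff every leg is on copy `0`;
* **`klSrcPinnedSumAt_zero_le_klWtPinnedSumAt`** — `klSrcPinnedSumAt … J r n 0 m q w ≤ klWtPinnedSumAt … J r m (𝒱_n) q w.1` (equality when `w` is on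
  copy `0`, the left side vanishes otherwise): the all-alive strings of `klSrcActionAt … J n` ARE the `F_J`-sectorised strings of `𝒱_n`
  (`kernel_klSrcActionAt_alive`, `kernel_map_sectorAnalysis`), with the same tree weight (`srcLegPos = latticeLegPos ∘ fst`);
* **`wtProfileEven_srcTrunc_klTowerD_of_readout`** — `TowerVolumeDataT.profile` at step `j` from E1's read-out bound
  `klWtPinnedSumAt … j r m (𝒱_{j+1}) q w ≤ S₀ m` and token #24 `SourceProfilesAtLev S … j r (j+1)`, budget `ε·(S₀ (2m) + S 1 (2m) + S 2 (2m))`, any `Λ ≤ Λ_r`.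

Proofs only; no definition. [cite: BenfattoGiulianiMastropietro2006, §2.7 (2.70)–(2.71), §2.9 (4.3)–(4.6)]
-/

noncomputable section

namespace Summit.HubbardSuperconductivity.HubbardSuperconductivity.Theorems.TwoVolumeSource

set_option linter.dupNamespace false -- summit = problem name (single-conjunct summit), D-0017

open Finset Filter Topology Literature.MathematicalPhysics.QuantumLattice GrassmannAlgebra Literature.Probability.LatticeModels
  Literature.Probability.LatticeModels.BattleFederbush
open Summit.HubbardSuperconductivity.HubbardSuperconductivity.Theorems.TwoPointAssembly
open Summit.HubbardSuperconductivity.HubbardSuperconductivity.Theorems.KLRegimeSplit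
open Summit.HubbardSuperconductivity.HubbardSuperconductivity.Theorems.KLProgrammeLegKernels
open Summit.HubbardSuperconductivity.HubbardSuperconductivity.Theorems.EngineV8
open Summit.HubbardSuperconductivity.HubbardSuperconductivity.Theorems.TwoVolumeDefect

variable {V M : ℕ} [NeZero V] [NeZero M]

omit [NeZero V] [NeZero M] in
/-- A doubled string has source count `0` iff every leg is on copy `0`. [folklore] -/
theorem srcCount_eq_zero_iff {J m : ℕ} (X : Fin m → SrcLabel V M J) :
    srcCount (fun q : SrcLabel V M J => q.2 = 1) X = 0 ↔ ∀ i, (X i).2 = 0 := by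
  unfold srcCount
  rw [card_eq_zero, filter_eq_empty_iff]
  constructor
  · intro h i
    have h1 : ¬ (X i).2 = 1 := h (mem_univ i)
    omega
  · intro h i _ h1
    rw [h i] at h1
    exact absurd h1 (by decide)

omit [NeZero M] in
/-- **The all-alive part of token #24's pinned sum is E1's read-out**: `klSrcPinnedSumAt … J r n 0 m q w ≤ klWtPinnedSumAt … J r m (𝒱_n) q w.1`
(`0 ≤ β`). [cite: BenfattoGiulianiMastropietro2006, §2.7 (2.70)] -/
theorem klSrcPinnedSumAt_zero_le_klWtPinnedSumAt {β : ℝ} (hβ : 0 ≤ β) (U μ : ℝ) (K : TrigPolyC4v) (J r n m : ℕ) (q : Fin m) (w : SrcLabel V M J) :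
    klSrcPinnedSumAt V M β U μ K J r n 0 m q w ≤ klWtPinnedSumAt V M β μ K J r m (klEffectiveAction V M β U μ K klE0 n) q w.1 := by
  classical
  rw [klSrcPinnedSumAt_def]
  unfold klWtPinnedSumAt
  refine mul_le_mul_of_nonneg_left ?_ (pow_nonneg (imagTimeWeight_nonneg hβ M) _)
  -- the all-alive strings, their alive projections, the target filter
  set A := univ.filter (fun X : Fin m → SrcLabel V M J => X q = w ∧ srcCount (fun q : SrcLabel V M J => q.2 = 1) X = 0) with hA
  set e : (Fin m → SrcLabel V M J) → (Fin m → SpaceTimeIdx V M × SectorLeg (sectorCount J)) := fun X i => (X i).1 with he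
  set g : (Fin m → SpaceTimeIdx V M × SectorLeg (sectorCount J)) → ℝ := fun Xa =>
    klScaleWt V M β r ((univ.image Xa).image (latticeLegPos (2 * (2 * M)))) *
      ‖kernel ℂ (ExteriorAlgebra.map (Matrix.toLin' (sectorAnalysisMatrix V M β (klAnisoFamily V M β μ K klE0 J)))
        (klEffectiveAction V M β U μ K klE0 n)) m Xa‖ with hg
  have hcopy : ∀ X ∈ A, ∀ i, (X i).2 = 0 := fun X hX => by
    simp only [hA, mem_filter, mem_univ, true_and] at hX
    exact (srcCount_eq_zero_iff X).1 hX.2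
  -- `e` is injective on the all-alive strings
  have hinj : Set.InjOn e A := by
    intro X hX X' hX' hXX'
    funext i
    have h1 : (X i).1 = (X' i).1 := congrFun hXX' i
    have h2 : (X i).2 = (X' i).2 := by rw [hcopy X hX i, hcopy X' hX' i]
    exact Prod.ext h1 h2
  -- the summands agree along `e`
  have hfg : ∀ X ∈ A, klScaleWt V M β r ((univ.image X).image (srcLegPos V M (2 * (2 * M)))) * ‖kernel ℂ (klSrcActionAt V M β U μ K J n) m X‖ = g (e X) := by
    intro X hX
    simp only [hg, he]
    rw [image_image, image_image, kernel_klSrcActionAt_alive β U μ K J n m X (hcopy X hX), kernel_map_sectorAnalysis]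
    rfl
  -- the image lies in the target filter
  have hsub : A.image e ⊆ univ.filter (fun Xa : Fin m → SpaceTimeIdx V M × SectorLeg (sectorCount J) => Xa q = w.1) := by
    intro Xa hXa
    simp only [mem_image] at hXa
    obtain ⟨X, hX, rfl⟩ := hXa
    simp only [hA, mem_filter, mem_univ, true_and] at hX
    simp only [mem_filter, mem_univ, true_and, he, hX.1]
  have hg0 : ∀ Xa, 0 ≤ g Xa := fun Xa => mul_nonneg (zero_le_one.trans (one_le_klScaleWt _ _ _ _ _)) (norm_nonneg _)
  calc ∑ X ∈ A, klScaleWt V M β r ((univ.image X).image (srcLegPos V M (2 * (2 * M)))) * ‖kernel ℂ (klSrcActionAt V M β U μ K J n) m X‖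
      = ∑ X ∈ A, g (e X) := sum_congr rfl hfg
    _ = ∑ Xa ∈ A.image e, g Xa := (sum_image hinj).symm
    _ ≤ _ := sum_le_sum_of_subset_of_nonneg hsub fun Xa _ _ => hg0 Xa

/-- **`TowerVolumeDataT.profile` FROM E1's READ-OUT ⊕ TOKEN #24** (see the module docstring). [cite: BenfattoGiulianiMastropietro2006, §2.9 (4.3)-(4.6)] -/
theorem wtProfileEven_srcTrunc_klTowerD_of_readout {β : ℝ} (hβ : 0 < β) (U μ : ℝ) (K : TrigPolyC4v) (j r : ℕ) {Λ : ℝ}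
    (hΛr : Λ ≤ klScale klE0 r) (S₀ : ℕ → ℝ) (S : ℕ → ℕ → ℝ) (hS₀ : ∀ m, 0 ≤ S₀ m) (hS : ∀ s m, 0 ≤ S s m)
    (h0 : ∀ (m : ℕ) (q : Fin m) (w : SpaceTimeIdx V M × SectorLeg (sectorCount j)),
      klWtPinnedSumAt V M β μ K j r m (klEffectiveAction V M β U μ K klE0 (j + 1)) q w ≤ S₀ m)
    (h12 : SourceProfilesAtLev V M S β U μ K j r (j + 1)) :
    WtProfileEven (srcTrunc ℂ (fun q : SrcLabel V M j => q.2 = 1) 3 (klTowerD V M β U μ K j)) Λ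
      (fun m => imagTimeWeight β M * (S₀ (2 * m) + S 1 (2 * m) + S 2 (2 * m))) := by
  have h := wtProfileEven_srcTrunc_klTowerD_of_srcPinnedSumAt hβ U μ K j r hΛr (fun s m => if s = 0 then S₀ m else S s m)
    (fun s m => by
      show 0 ≤ (if s = 0 then S₀ m else S s m)
      split_ifs; exacts [hS₀ m, hS s m])
    (fun s hs m q w => by
      show klSrcPinnedSumAt V M β U μ K j r (j + 1) s m q w ≤ (if s = 0 then S₀ m else S s m)
      split_ifs with h0'
      · subst h0'; exact (klSrcPinnedSumAt_zero_le_klWtPinnedSumAt hβ.le U μ K j r (j + 1) m q w).trans (h0 m q w.1)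
      · exact h12 s (by omega) hs m q w)
  simpa using h

end Summit.HubbardSuperconductivity.HubbardSuperconductivity.Theorems.TwoVolumeSource

end
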